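import Summits.AtomisticToContinuum.Crystallization.Theorems.PricedLinkCensusTruncatedCensusGapHarmonicBlochPositivity

/-!
# Crux `PricedLinkCensus.TruncatedCensusGap` (stmt-AtomisticToContinuum-14230), line `near-far-split`,
# stub N2 `stub_harmonicCoercivityWindow`: block-convolution forms pushed forward to a finite torus

Companion of `…HarmonicBlochPositivity`.  The quadratic forms of N2 live on an INFINITE lattice
(`A = ℤ²` in-plane cells, or `ℤ³`), with a finite-range block kernel `K` (support `R`) and a
finitely supported field `u` (support `S`).  Pushing everything forward along an additive map
`π : A →+ G` to a FINITE abelian group `G` (a discrete torus so large that no bond wraps around: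
`π (x - y) = π d` with `x, y ∈ S`, `d ∈ R` forces `x - y = d`) does not change the form
(`sum_sum_blockConv_eq_pushforward`), and the symbol of the pushed-forward kernel at a character
`ψ` of `G` is `Σ_{d ∈ R} ψ(π d) K d` (`sum_smul_pushforwardKernel_eq`).  Hence (block Bochner,
`blockConvForm_nonneg_of_symbol_real`) **the lattice form is nonnegative as soon as
`Re vᴴ (Σ_{d ∈ R} ψ(π d) K d) v ≥ 0` for every character `ψ` of the torus**
(`blockConv_nonneg_of_pushforward_symbol`).  For `A = ℤᵏ`, `G = (ℤ/L)ᵏ` these symbols are the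
Bloch/LMI matrices of N2 at the frequencies `ξ ∈ L⁻¹ℤᵏ`.  All `[folklore]`, `def`-free.
-/

noncomputable section

namespace Summit.AtomisticToContinuum.Crystallization.Theorems.PricedLinkCensusTruncatedCensusGap

open scoped BigOperators ComplexConjugate
open Finset

variable {A G : Type*} [AddCommGroup A] [AddCommGroup G] [Fintype G] [DecidableEq G]
variable {ι : Type*} [Fintype ι]

omit [Fintype G] [Fintype ι] in
/-- Under the no-wrap-around hypothesis, the pushed-forward kernel seen between the images of two
support points is the original kernel: `Σ_{d ∈ R, π d = π (x - y)} K d = K (x - y)`. [folklore] -/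
theorem sum_filter_kernel_eq (π : A →+ G) (S R : Finset A) (K : A → Matrix ι ι ℝ)
    (hK : ∀ d, d ∉ R → K d = 0)
    (hwrap : ∀ x ∈ S, ∀ y ∈ S, ∀ d ∈ R, π (x - y) = π d → x - y = d)
    {x y : A} (hx : x ∈ S) (hy : y ∈ S) :
    ∑ d ∈ R with π d = π x - π y, K d = K (x - y) := by
  classical
  have hsub : (R.filter fun d => π d = π x - π y) ⊆ {x - y} := by
    intro d hd
    rw [Finset.mem_filter] at hd
    rw [Finset.mem_singleton]
    exact (hwrap x hx y hy d hd.1 (by rw [map_sub, hd.2])).symm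
  by_cases hxy : x - y ∈ R
  · have heq : (R.filter fun d => π d = π x - π y) = {x - y} := by
      refine Finset.Subset.antisymm hsub ?_
      intro d hd
      rw [Finset.mem_singleton] at hd
      subst hd
      exact Finset.mem_filter.2 ⟨hxy, by rw [map_sub]⟩
    rw [heq, Finset.sum_singleton]
  · have hempty : (R.filter fun d => π d = π x - π y) = ∅ := by
      rw [Finset.eq_empty_iff_forall_notMem]
      intro d hd
      have := hsub hd
      rw [Finset.mem_singleton] at this
      subst this
      exact hxy (Finset.mem_filter.1 hd).1
    rw [hempty, Finset.sum_empty, hK _ hxy]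

/-- **The lattice form equals the torus form.**  With `ũ g = Σ_{x ∈ S, π x = g} u x` and
`K̃ g = Σ_{d ∈ R, π d = g} K d`:
`Σ_{x,y ∈ S} u(x)ᵀ K(x - y) u(y) = Σ_{g,g' ∈ G} ũ(g)ᵀ K̃(g - g') ũ(g')`, provided no bond wraps
around the torus. [folklore] -/
theorem sum_sum_blockConv_eq_pushforward (π : A →+ G) (S R : Finset A) (u : A → ι → ℝ)
    (K : A → Matrix ι ι ℝ) (hK : ∀ d, d ∉ R → K d = 0)
    (hwrap : ∀ x ∈ S, ∀ y ∈ S, ∀ d ∈ R, π (x - y) = π d → x - y = d) :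
    ∑ x ∈ S, ∑ y ∈ S, u x ⬝ᵥ (K (x - y)).mulVec (u y) =
      ∑ g, ∑ g', (∑ x ∈ S with π x = g, u x) ⬝ᵥ
        (∑ d ∈ R with π d = g - g', K d).mulVec (∑ y ∈ S with π y = g', u y) := by
  classical
  symm
  calc ∑ g, ∑ g', (∑ x ∈ S with π x = g, u x) ⬝ᵥ
          (∑ d ∈ R with π d = g - g', K d).mulVec (∑ y ∈ S with π y = g', u y)
      = ∑ g, ∑ g', ∑ x ∈ S with π x = g, ∑ y ∈ S with π y = g',
          u x ⬝ᵥ (∑ d ∈ R with π d = g - g', K d).mulVec (u y) := by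
        refine Finset.sum_congr rfl fun g _ => Finset.sum_congr rfl fun g' _ => ?_
        rw [sum_dotProduct]
        refine Finset.sum_congr rfl fun x _ => ?_
        rw [Matrix.mulVec_sum, dotProduct_sum]
    _ = ∑ g, ∑ g', ∑ x ∈ S with π x = g, ∑ y ∈ S with π y = g',
          u x ⬝ᵥ (K (x - y)).mulVec (u y) := by
        refine Finset.sum_congr rfl fun g _ => Finset.sum_congr rfl fun g' _ =>
          Finset.sum_congr rfl fun x hx => Finset.sum_congr rfl fun y hy => ?_
        rw [Finset.mem_filter] at hx hy
        rw [← hx.2, ← hy.2, sum_filter_kernel_eq π S R K hK hwrap hx.1 hy.1]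
    _ = ∑ g, ∑ x ∈ S with π x = g, ∑ g', ∑ y ∈ S with π y = g',
          u x ⬝ᵥ (K (x - y)).mulVec (u y) := by
        refine Finset.sum_congr rfl fun g _ => ?_
        rw [Finset.sum_comm]
    _ = ∑ g, ∑ x ∈ S with π x = g, ∑ y ∈ S, u x ⬝ᵥ (K (x - y)).mulVec (u y) := by
        refine Finset.sum_congr rfl fun g _ => Finset.sum_congr rfl fun x _ => ?_
        exact Finset.sum_fiberwise S π _
    _ = ∑ x ∈ S, ∑ y ∈ S, u x ⬝ᵥ (K (x - y)).mulVec (u y) := Finset.sum_fiberwise S π _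

omit [Fintype ι] in
/-- **The symbol of the pushed-forward kernel** at a character `ψ` of the torus:
`Σ_g ψ(g) K̃(g) = Σ_{d ∈ R} ψ(π d) K d` (complexified). [folklore] -/
theorem sum_smul_pushforwardKernel_eq (π : A →+ G) (R : Finset A) (K : A → Matrix ι ι ℝ)
    (ψ : AddChar G ℂ) :
    ∑ g, ψ g • (∑ d ∈ R with π d = g, K d).map ((↑) : ℝ → ℂ) =
      ∑ d ∈ R, ψ (π d) • (K d).map ((↑) : ℝ → ℂ) := by
  classical
  have hmap : ∀ g, (∑ d ∈ R with π d = g, K d).map ((↑) : ℝ → ℂ) =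
      ∑ d ∈ R with π d = g, (K d).map ((↑) : ℝ → ℂ) := by
    intro g
    ext i j
    simp [Matrix.sum_apply]
  simp_rw [hmap, Finset.smul_sum]
  rw [← Finset.sum_fiberwise R π (fun d => ψ (π d) • (K d).map ((↑) : ℝ → ℂ))]
  refine Finset.sum_congr rfl fun g _ => Finset.sum_congr rfl fun d hd => ?_
  rw [(Finset.mem_filter.1 hd).2]

/-- **Positivity of a lattice block-convolution form from its torus symbols.**  If no bond wraps
around (`hwrap`) and `Re vᴴ (Σ_{d ∈ R} ψ(π d) K d) v ≥ 0` for every character `ψ` of the finite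
torus `G` and every complex `v`, then `Σ_{x,y ∈ S} u(x)ᵀ K(x - y) u(y) ≥ 0`. [folklore] -/
theorem blockConv_nonneg_of_pushforward_symbol (π : A →+ G) (S R : Finset A) (u : A → ι → ℝ)
    (K : A → Matrix ι ι ℝ) (hK : ∀ d, d ∉ R → K d = 0)
    (hwrap : ∀ x ∈ S, ∀ y ∈ S, ∀ d ∈ R, π (x - y) = π d → x - y = d)
    (hpos : ∀ (ψ : AddChar G ℂ) (v : ι → ℂ),
      0 ≤ (star v ⬝ᵥ (∑ d ∈ R, ψ (π d) • (K d).map ((↑) : ℝ → ℂ)).mulVec v).re) :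
    0 ≤ ∑ x ∈ S, ∑ y ∈ S, u x ⬝ᵥ (K (x - y)).mulVec (u y) := by
  classical
  rw [sum_sum_blockConv_eq_pushforward π S R u K hK hwrap]
  refine blockConvForm_nonneg_of_symbol_real (fun g => ∑ d ∈ R with π d = g, K d) ?_ _
  intro ψ v
  rw [sum_smul_pushforwardKernel_eq π R K ψ]
  exact hpos ψ v


/-- **Lattice form ≥ 0 from torus symbols, registered form** (types in `Type`): a finite-range
block-convolution form on an infinite abelian group, evaluated on a finitely supported field, is
nonnegative as soon as the symbols `Σ_{d ∈ R} ψ(π d) K d` are positive (real part of the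
Hermitian form) at every character `ψ` of some finite torus `π : A →+ G` around which no bond of
the support wraps.  For N2: `A = ℤ²` (cells of a layer triple) or `ℤ³`, `G = (ℤ/L)ᵏ`, `L` larger
than the support diameter plus the range. [folklore] -/
theorem latticeForm_nonneg_of_torusSymbol :
    ∀ {A G : Type} [AddCommGroup A] [AddCommGroup G] [Fintype G] [DecidableEq G] {ι : Type} [Fintype ι] (π : A →+ G) (S R : Finset A) (u : A → ι → ℝ) (K : A → Matrix ι ι ℝ), (∀ d, d ∉ R → K d = 0) → (∀ x ∈ S, ∀ y ∈ S, ∀ d ∈ R, π (x - y) = π d → x - y = d) → (∀ (ψ : AddChar G ℂ) (v : ι → ℂ), 0 ≤ (star v ⬝ᵥ (∑ d ∈ R, ψ (π d) • (K d).map ((↑) : ℝ → ℂ)).mulVec v).re) → 0 ≤ ∑ x ∈ S, ∑ y ∈ S, u x ⬝ᵥ (K (x - y)).mulVec (u y) :=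
  fun π S R u K hK hwrap hpos => blockConv_nonneg_of_pushforward_symbol π S R u K hK hwrap hpos

end Summit.AtomisticToContinuum.Crystallization.Theorems.PricedLinkCensusTruncatedCensusGap

end
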